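import Summits.QuantumFields.YangMills.Theorems.UnitScaleTiltProp7GaugePieceRows
import Summits.QuantumFields.YangMills.Theorems.UnitScaleTiltProp7CovDivProductRules
import HarnessLib

/-!
# Prop 7, route-R E′, (E1-c) brick F4c(iv-b) — THE NONLINEAR PART `𝒩` OF `P₂` UNDER `ℓ²D*_W` (CRUDE RULE), PACKAGED: `≤ 2|ι|·ℓ²·[(A+2A²)(δ+δ′)δ_d + (4A∕3+6A²)(δ+δ′)²m_d]`

Route `UnitScaleTilt`, crux K1 child «MinimiserStabilityRegPr» (`stmt-QuantumFields-19200`), cell ym3-torus, width seat px15 (gen 2); pen «px15 g2: (E1-c) GO-LOCATE» (★p1 g15,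
2026-08-28T20:45:05Z), LOCATE `LOCATE-E1C-DIVLIPSCHITZ-px15g2.md` §6 (F4).  THEOREMS ONLY (0 `def`, 0 `sorry`); `--supports stmt-QuantumFields-19200`, count-neutral.
YM₃ on T³ is a ladder rung (R3), not the Clay problem; nothing here claims the stub, the crux, d = 4 or the mass gap.

WHAT.  With `X_ψ(y) := c•ψ(y)`, `H_ψ(μ,y) := c•D_μψ(y)` (`|c| ≤ 1`), the nonlinear part of the pure-gauge piece at the bond `(y, μ)` is
`𝒩ψ(μ,y) := log(1 + e^{−X}(e^{X+H} − e^X)) − H − (g(ad X)H − H)` (F3c ✓p671341 `gaugeNonlin_eq`).  No resummation is needed for it: the CRUDE rule (`‖D*P(x)‖ ≤ Σ_μ(‖P_μ(x−e_μ)‖ + ‖P_μ x‖)`,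
here `norm_divB_le_sum'` with norm-preserving transports as the only input) and F3c's joint row `norm_gaugeNonlin_sub_le` (`K := δ + δ′` bounds both data, `R₀` both fields,
`A := e^{R₀}e^{R₀+K}`, smallness `A·K ≤ ½`) give at every site
  ★★★ `norm_divB_nonlinPart_le`: `ℓ²‖D*[𝒩ψ − 𝒩ψ′](x)‖ ≤ 2|ι|·ℓ²·[(A + 2A²)·K·δ_d + (4A∕3 + 6A²)·K²·m_d]`
— and `ℓ²Kδ_d = (ℓK)(ℓδ_d)`, `ℓ²K²m_d = (ℓK)²m_d` are products of X-currency rows: `≤ C·(pψ + pψ′)(1 + pψ + pψ′)·p(ψ−ψ′)`.  Also the bond (ℓ·sup) member `norm_nonlinPart_sub_le`.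
HONEST SCOPE.  Bookkeeping ([folklore]) over F3c; F1's abstract `(T,U)` letters on `M_N(ℂ)` (L²-operator norm).

References: T. Bałaban, CMP 99 (1985) 389–434 [Balaban1985BackgroundPropagators] ((3.8) p.392); CMP 98 (1985) 17–51 [Balaban1985Averaging] ((26) p.22, (32)–(34) p.22).
-/

set_option autoImplicit false

noncomputable section

open scoped BigOperators Matrix.Norms.L2Operator Matrix
open NormedSpace

namespace Summit.QuantumFields.YangMills.Theorems.Prop7NonlinPartPackaged

open Literature.MathematicalPhysics.QuantumFieldTheory.Balaban1983to89
open Finset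
open B9Eq39Adjoint (R R_def R_add R_sub covD covDstar divB)
open Literature.Analysis.Calculus.ExpDifferential (gSer ad)
open Literature.Analysis.Complex (logOnePlus)
open Summit.QuantumFields.YangMills.Theorems.Prop7GaugePieceRows (norm_gaugeNonlin_sub_le)

variable {n : Type*} [Fintype n] [DecidableEq n] [Nonempty n]
variable {S : Type*} {ι : Type*} (T : ι → Equiv.Perm S) (U : ι → S → (Matrix n n ℂ)ˣ)

omit [Nonempty n] in
/-- One direction of the crude rule: `‖D*_μP(x)‖ ≤ ‖P(x − e_μ)‖ + ‖P(x)‖` (norm-preserving transport). [cite: Balaban1985BackgroundPropagators, (3.8) p.392] -/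
theorem norm_covDstar_le_add' (hRn : ∀ μ x (M : Matrix n n ℂ), ‖R (U μ x)⁻¹ M‖ = ‖M‖) (μ : ι) (P : S → Matrix n n ℂ) (x : S) :
    ‖covDstar T U μ P x‖ ≤ ‖P ((T μ).symm x)‖ + ‖P x‖ := by
  simp only [covDstar]
  exact (norm_sub_le _ _).trans (by rw [hRn])

variable [Fintype ι]

omit [Nonempty n] in
/-- THE CRUDE RULE (abstract transports): `‖D*P(x)‖ ≤ Σ_μ(‖P_μ(x − e_μ)‖ + ‖P_μ(x)‖)`. [cite: Balaban1985BackgroundPropagators, (3.8) p.392] -/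
theorem norm_divB_le_sum' (hRn : ∀ μ x (M : Matrix n n ℂ), ‖R (U μ x)⁻¹ M‖ = ‖M‖) (P : ι → S → Matrix n n ℂ) (x : S) :
    ‖divB T U P x‖ ≤ ∑ μ, (‖P μ ((T μ).symm x)‖ + ‖P μ x‖) := by
  unfold divB
  exact (norm_sum_le _ _).trans (Finset.sum_le_sum fun μ _ => norm_covDstar_le_add' T U hRn μ (P μ) x)

omit [Fintype ι] in
/-- ★ THE BOND ROW of the nonlinear part: `‖𝒩ψ(μ,y) − 𝒩ψ′(μ,y)‖ ≤ (A + 2A²)·K·δ_d + (4A∕3 + 6A²)·K²·m_d` (F3c's joint row in the lattice letters). [cite: Balaban1985Averaging, (32)-(34) p.22] -/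
theorem norm_nonlinPart_sub_le {c : ℂ} (hc : ‖c‖ ≤ 1) (ψ ψ' : S → Matrix n n ℂ) {R₀ md δ δ' δd : ℝ}
    (hm : ∀ y, ‖ψ y‖ ≤ R₀) (hm' : ∀ y, ‖ψ' y‖ ≤ R₀) (hmd : ∀ y, ‖ψ y - ψ' y‖ ≤ md)
    (hδ0 : 0 ≤ δ) (hδ : ∀ μ y, ‖covD T U μ ψ y‖ ≤ δ) (hδ'0 : 0 ≤ δ') (hδ' : ∀ μ y, ‖covD T U μ ψ' y‖ ≤ δ')
    (hδd : ∀ μ y, ‖covD T U μ ψ y - covD T U μ ψ' y‖ ≤ δd)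
    (hs : Real.exp R₀ * Real.exp (R₀ + (δ + δ')) * (δ + δ') ≤ 1 / 2) (μ : ι) (y : S) :
    ‖(logOnePlus (exp (-(c • ψ y)) * (exp (c • ψ y + c • covD T U μ ψ y) - exp (c • ψ y))) - c • covD T U μ ψ y
          - (gSer ℂ (ad ℂ (c • ψ y)) (c • covD T U μ ψ y) - c • covD T U μ ψ y))
        - (logOnePlus (exp (-(c • ψ' y)) * (exp (c • ψ' y + c • covD T U μ ψ' y) - exp (c • ψ' y))) - c • covD T U μ ψ' y
          - (gSer ℂ (ad ℂ (c • ψ' y)) (c • covD T U μ ψ' y) - c • covD T U μ ψ' y))‖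
      ≤ ((Real.exp R₀ * Real.exp (R₀ + (δ + δ'))) + 2 * (Real.exp R₀ * Real.exp (R₀ + (δ + δ'))) ^ 2) * (δ + δ') * δd
        + (4 / 3 * (Real.exp R₀ * Real.exp (R₀ + (δ + δ'))) + 6 * (Real.exp R₀ * Real.exp (R₀ + (δ + δ'))) ^ 2) * (δ + δ') ^ 2 * md := by
  have hcn : ∀ M : Matrix n n ℂ, ‖c • M‖ ≤ ‖M‖ := fun M => by
    rw [norm_smul]; nlinarith [norm_nonneg c, norm_nonneg M]
  have hx : ‖c • ψ y‖ ≤ R₀ := (hcn _).trans (hm y)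
  have hx' : ‖c • ψ' y‖ ≤ R₀ := (hcn _).trans (hm' y)
  have hh : ‖c • covD T U μ ψ y‖ ≤ δ + δ' := (hcn _).trans ((hδ μ y).trans (le_add_of_nonneg_right hδ'0))
  have hh' : ‖c • covD T U μ ψ' y‖ ≤ δ + δ' := (hcn _).trans ((hδ' μ y).trans (le_add_of_nonneg_left hδ0))
  have h := norm_gaugeNonlin_sub_le hx hx' hh hh' hs
  refine h.trans ?_
  have hA : 0 ≤ Real.exp R₀ * Real.exp (R₀ + (δ + δ')) := by positivity
  have hK : 0 ≤ δ + δ' := add_nonneg hδ0 hδ'0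
  have hHd : ‖c • covD T U μ ψ y - c • covD T U μ ψ' y‖ ≤ δd := by rw [← smul_sub]; exact (hcn _).trans (hδd μ y)
  have hXd : ‖c • ψ y - c • ψ' y‖ ≤ md := by rw [← smul_sub]; exact (hcn _).trans (hmd y)
  have h1 := mul_le_mul_of_nonneg_left hHd (by positivity : 0 ≤ ((Real.exp R₀ * Real.exp (R₀ + (δ + δ'))) + 2 * (Real.exp R₀ * Real.exp (R₀ + (δ + δ'))) ^ 2) * (δ + δ'))
  have h2 := mul_le_mul_of_nonneg_left hXd (by positivity : 0 ≤ (4 / 3 * (Real.exp R₀ * Real.exp (R₀ + (δ + δ'))) + 6 * (Real.exp R₀ * Real.exp (R₀ + (δ + δ'))) ^ 2) * (δ + δ') ^ 2)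
  exact add_le_add h1 h2

/-- ★★★ **THE NONLINEAR PART UNDER `ℓ²D*`** (crude rule + bond row): `ℓ²‖D*[𝒩ψ − 𝒩ψ′](x)‖ ≤ 2|ι|·ℓ²·[(A + 2A²)·K·δ_d + (4A∕3 + 6A²)·K²·m_d]`, `K = δ + δ′`, `A = e^{R₀}e^{R₀+K}`.
[cite: Balaban1985BackgroundPropagators, (3.8) p.392] [cite: Balaban1985Averaging, (32)-(34) p.22] -/
theorem norm_divB_nonlinPart_le (hRn : ∀ μ x (M : Matrix n n ℂ), ‖R (U μ x)⁻¹ M‖ = ‖M‖) {c : ℂ} (hc : ‖c‖ ≤ 1)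
    (ψ ψ' : S → Matrix n n ℂ) {R₀ md δ δ' δd : ℝ}
    (hm : ∀ y, ‖ψ y‖ ≤ R₀) (hm' : ∀ y, ‖ψ' y‖ ≤ R₀) (hmd : ∀ y, ‖ψ y - ψ' y‖ ≤ md)
    (hδ0 : 0 ≤ δ) (hδ : ∀ μ y, ‖covD T U μ ψ y‖ ≤ δ) (hδ'0 : 0 ≤ δ') (hδ' : ∀ μ y, ‖covD T U μ ψ' y‖ ≤ δ')
    (hδd : ∀ μ y, ‖covD T U μ ψ y - covD T U μ ψ' y‖ ≤ δd)
    (hs : Real.exp R₀ * Real.exp (R₀ + (δ + δ')) * (δ + δ') ≤ 1 / 2) (ℓ : ℕ) (x : S) :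
    (ℓ : ℝ) ^ 2 * ‖divB T U (fun μ y =>
        (logOnePlus (exp (-(c • ψ y)) * (exp (c • ψ y + c • covD T U μ ψ y) - exp (c • ψ y))) - c • covD T U μ ψ y
            - (gSer ℂ (ad ℂ (c • ψ y)) (c • covD T U μ ψ y) - c • covD T U μ ψ y))
          - (logOnePlus (exp (-(c • ψ' y)) * (exp (c • ψ' y + c • covD T U μ ψ' y) - exp (c • ψ' y))) - c • covD T U μ ψ' y
            - (gSer ℂ (ad ℂ (c • ψ' y)) (c • covD T U μ ψ' y) - c • covD T U μ ψ' y))) x‖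
      ≤ 2 * (Fintype.card ι : ℝ) * (ℓ : ℝ) ^ 2 *
        ((((Real.exp R₀ * Real.exp (R₀ + (δ + δ'))) + 2 * (Real.exp R₀ * Real.exp (R₀ + (δ + δ'))) ^ 2) * (δ + δ') * δd)
          + ((4 / 3 * (Real.exp R₀ * Real.exp (R₀ + (δ + δ'))) + 6 * (Real.exp R₀ * Real.exp (R₀ + (δ + δ'))) ^ 2) * (δ + δ') ^ 2 * md)) := by
  set Bnd := (((Real.exp R₀ * Real.exp (R₀ + (δ + δ'))) + 2 * (Real.exp R₀ * Real.exp (R₀ + (δ + δ'))) ^ 2) * (δ + δ') * δd)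
          + ((4 / 3 * (Real.exp R₀ * Real.exp (R₀ + (δ + δ'))) + 6 * (Real.exp R₀ * Real.exp (R₀ + (δ + δ'))) ^ 2) * (δ + δ') ^ 2 * md) with hBnd
  have hb : ∀ μ y, ‖(logOnePlus (exp (-(c • ψ y)) * (exp (c • ψ y + c • covD T U μ ψ y) - exp (c • ψ y))) - c • covD T U μ ψ y
          - (gSer ℂ (ad ℂ (c • ψ y)) (c • covD T U μ ψ y) - c • covD T U μ ψ y))
        - (logOnePlus (exp (-(c • ψ' y)) * (exp (c • ψ' y + c • covD T U μ ψ' y) - exp (c • ψ' y))) - c • covD T U μ ψ' y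
          - (gSer ℂ (ad ℂ (c • ψ' y)) (c • covD T U μ ψ' y) - c • covD T U μ ψ' y))‖ ≤ Bnd :=
    fun μ y => norm_nonlinPart_sub_le T U hc ψ ψ' hm hm' hmd hδ0 hδ hδ'0 hδ' hδd hs μ y
  have hcrude := norm_divB_le_sum' T U hRn (fun μ y =>
        (logOnePlus (exp (-(c • ψ y)) * (exp (c • ψ y + c • covD T U μ ψ y) - exp (c • ψ y))) - c • covD T U μ ψ y
            - (gSer ℂ (ad ℂ (c • ψ y)) (c • covD T U μ ψ y) - c • covD T U μ ψ y))
          - (logOnePlus (exp (-(c • ψ' y)) * (exp (c • ψ' y + c • covD T U μ ψ' y) - exp (c • ψ' y))) - c • covD T U μ ψ' y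
            - (gSer ℂ (ad ℂ (c • ψ' y)) (c • covD T U μ ψ' y) - c • covD T U μ ψ' y))) x
  have hsum : ∑ μ : ι, (‖(logOnePlus (exp (-(c • ψ ((T μ).symm x))) * (exp (c • ψ ((T μ).symm x) + c • covD T U μ ψ ((T μ).symm x)) - exp (c • ψ ((T μ).symm x))))
            - c • covD T U μ ψ ((T μ).symm x) - (gSer ℂ (ad ℂ (c • ψ ((T μ).symm x))) (c • covD T U μ ψ ((T μ).symm x)) - c • covD T U μ ψ ((T μ).symm x)))
          - (logOnePlus (exp (-(c • ψ' ((T μ).symm x))) * (exp (c • ψ' ((T μ).symm x) + c • covD T U μ ψ' ((T μ).symm x)) - exp (c • ψ' ((T μ).symm x))))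
            - c • covD T U μ ψ' ((T μ).symm x) - (gSer ℂ (ad ℂ (c • ψ' ((T μ).symm x))) (c • covD T U μ ψ' ((T μ).symm x)) - c • covD T U μ ψ' ((T μ).symm x)))‖
        + ‖(logOnePlus (exp (-(c • ψ x)) * (exp (c • ψ x + c • covD T U μ ψ x) - exp (c • ψ x))) - c • covD T U μ ψ x
            - (gSer ℂ (ad ℂ (c • ψ x)) (c • covD T U μ ψ x) - c • covD T U μ ψ x))
          - (logOnePlus (exp (-(c • ψ' x)) * (exp (c • ψ' x + c • covD T U μ ψ' x) - exp (c • ψ' x))) - c • covD T U μ ψ' x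
            - (gSer ℂ (ad ℂ (c • ψ' x)) (c • covD T U μ ψ' x) - c • covD T U μ ψ' x))‖)
      ≤ ∑ _μ : ι, (Bnd + Bnd) := Finset.sum_le_sum fun μ _ => add_le_add (hb μ _) (hb μ x)
  rw [Finset.sum_const, Finset.card_univ, nsmul_eq_mul] at hsum
  have hℓ2 : 0 ≤ (ℓ : ℝ) ^ 2 := sq_nonneg _
  calc _ ≤ (ℓ : ℝ) ^ 2 * (Fintype.card ι * (Bnd + Bnd)) := mul_le_mul_of_nonneg_left (hcrude.trans hsum) hℓ2
    _ = 2 * (Fintype.card ι : ℝ) * (ℓ : ℝ) ^ 2 * Bnd := by ring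

end Summit.QuantumFields.YangMills.Theorems.Prop7NonlinPartPackaged

end
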